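import Summits.QuantumFields.YangMills.Theorems.BalabanUVNodesN22W1StripRunTowers

/-!
# BalabanUVNodes ∕ node N22 = NE9 — THE STRIP INDUCTION AT THE W1 OBJECT, MODULE 16′: THE OLDER-COUPLING LEVEL-T HYPOTHESIS ON GENERATED TOWERS FROM TWO
# PER-STEP GENERATOR SCHEMAS — node N10's in-edge asked in node00-def-W1 g4's generator vocabulary `W1.StepGen` ([II] (2.14)–(2.26) with COMPLEX old terms on a
# common domain), couplings and histories ELIMINATED

Cell `pub-ymgap`, HUMAN RULING D-0062 (Track A), R134 ACCELERATION re-seat `pub-ymgap-dag-n22-c` (strategy s1), generation 4, module 16′.  THEOREMS ONLY; imports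
module 15′ `…N22W1StripRunTowers` (the knit on `runTowers` in the fixed-domain currency) and through it node00-def-W1 g4's `Node00.HistoryRecursionOfRecord` (the
one-step generator `StepGen P 𝔸 M k` = indices + generic term `T i t old φ` of the LAST coupling `t` and the OLDER TERMS `old : OlderTerms P 𝔸 M k`, the recursion
`recTerm`, the generated tower `toClusterTower G`, `toClusterTower_H`, `termC_toClusterTower`, `recTerm_congr_prefix`, `histOfPrefix_restrictPrefix`) BY NAME.
`--supports` K3′ (helper).

WHY.  In print the older couplings `g₀, …, g_{k−1}` enter the step-`k` activity `H^{(k)}(Z)` ONLY through the older terms `E^{(j)}`, `j ≤ k` ([I] p.256, [II] (2.15)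
p.15) — which is what W1 g4's `toClusterTower G` makes DEFINITIONAL.  So the OLDER-coupling level-T hypothesis `h226TOnOlder` of modules 14′ ∕ 15′ (a statement about
coupling histories `g|g_i := t`) is, ON A GENERATED TOWER, a consequence of two COUPLING-FREE per-step schemas on the generator: (S-loc) the activity reads the older
terms on the space tables only, and (S-226) for every older-terms CURVE holomorphic and (1.18)-bounded on a common open domain `D` (on the space tables), the activity
along the curve is holomorphic on `D` and dominated there termwise-(2.26) over print's `terms L M Z` — [II] (2.14)–(2.26) READ WITH COMPLEX OLD TERMS, the statement
the B13 apparatus proves for the generator of record (node N10's lane; the identification of `G` with that generator is NODE 00's, not made here).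

WHAT.
* §1 ★ `termwise226OnOlder_toClusterTower_of_stepSchemas` — for a generator tower `G` on the `k`-th torus: (S-loc)_{k′} + (S-226)_{k′} at the steps `k′ < K` ⟹ the
  `h226TOnOlder` body for `toClusterTower G` at the levels `k′ < K` (module 15′ §1's `hbelow` shape, literally).  Proof: the older-terms curve is CHOSEN from the premise
  (`Ec_{j,Y,ψ}` on the spaces, `0` off them); (S-226) gives `Hc z Z := (G k′).H ↑(g k′) (curve z) φ Z` with its domination; the trace clause is `toClusterTower_H` + (S-loc) +
  `termC_toClusterTower` + `recTerm_congr_prefix` ∕ `histOfPrefix_restrictPrefix` (the coupling `g_i`, `i < k′`, is not the last one).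
* §2 ★ `n22At_u3OfRecord₁₂_ofRecordAdm_runTowers_toClusterTower_of_n18Below_stepSchemas_eHoloAt` — module 15′ §3 at `S₀ k := toClusterTower (G k)`: `N22At` at the
  admissible reading of record on the towers of the runs of record GENERATED BY `G` ⇐ (S-loc) + (S-226) at the steps below the run length (N10, generator language) +
  node N09's `EHoloAt` family below the run length + node N18 below + numerals + the `hspk` inclusion.
* §2b ★ `s_N22_readingOfRecord₁₂_ofRecordAdm_runTowers_toClusterTower_of_s_N18_stepSchemas_eHoloAt` — THE ₁₂ EDGE N18 → N22 at that reading (module 15′ §4 at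
  generated towers): `S_N18 (RRec₁₂ 𝔯)` + signs + per `(F, θ, k)` ∃(tuple; `hspk`; numerals; (S-loc)+(S-226) below the run; `EHoloAt` below the run) ⟹ `S_N22 (RRec₁₂ 𝔯)`.
* §3 `stepSchemas_termlessGen` — NON-VACUITY (A5 rider): the termless generator (`idx Z = ∅`) carries (S-loc) and (S-226) (`Tt := 0`).

HONEST FRAMING.  Count-neutral by-name knit; NOT a discharge of N22.  (S-loc) and (S-226) are DISPLAYED hypothesis schemas on an abstract generator, asserted nowhere
([II] (2.14)–(2.26) per term with complex old terms — NOT PRINTED as such; print works at real couplings and real old terms, the complex reading is the tree's ROAD 3);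
the `EHoloAt` family is node N09's currency; `S_N18` ∕ `N18At` node N18's; the generator `G` is a PARAMETER (ref-F STANDING CHECK (g): counts only with `G` pinned BY NAME
to NODE 00's generator of record, not typed yet); statements at `ofRecordAdm` are vacuous where `AdmBg … k = ∅` (ref-H A1 WATCH).  NE9 NOT IN PRINT; one finite four-torus
programme at fixed ε — NOT infinite volume, NOT OS on ℝ⁴, NOT a mass gap, NOT Clay.  0 `sorry`, 0 `def`, standard axioms.

References (TYPES only): [I] = [Balaban1987RG1] §0 p. 256, (1.18) p. 263, (2.12)–(2.13) p. 268; [II] = [Balaban1988RG2Cluster] (1.41) p. 11, (2.9)–(2.15) pp. 14–15,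
(2.26) p. 17, (2.40)–(2.41) p. 21.
-/

noncomputable section

open scoped Matrix.Norms.L2Operator

namespace YMDAG.N22.W1

open Set Metric
open scoped BigOperators
open Literature.MathematicalPhysics.QuantumFieldTheory.Balaban1983to89
open Literature.MathematicalPhysics.QuantumFieldTheory.Balaban1983to89.T4Continuum
open Literature.MathematicalPhysics.QuantumFieldTheory.Balaban1983to89.T4OutputRate
open Literature.MathematicalPhysics.QuantumFieldTheory.Balaban1983to89.TreeLengthTorus (TPt TDom tsys torusTreeLen torusTreeLen_nonneg)
open Literature.MathematicalPhysics.QuantumFieldTheory.Balaban1983to89.B12TreeDecay (K₀ K₀_pos)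
open Literature.MathematicalPhysics.QuantumFieldTheory.Balaban1983to89.B13Lemma3TorusData (TBond)
open Literature.MathematicalPhysics.QuantumFieldTheory.Balaban1983to89.B13Lemma3TorusTerms (terms weight weight_nonneg)
open Literature.MathematicalPhysics.QuantumFieldTheory.Balaban1983to89.B13Lemma3TorusSocket (Lemma3Numerics)
open Literature.MathematicalPhysics.QuantumFieldTheory.Balaban1983to89.B12BetaHolo (EHoloAt)
open Literature.MathematicalPhysics.QuantumFieldTheory.Balaban1983to89.Step (SFConsts)
open Literature.MathematicalPhysics.QuantumFieldTheory.Balaban1983to89.Node00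
  (Stage12Params IsDatumOfRecord₁₂C U3Objects₁₁ U3Letters₁₁ MatA ιSU prependCoupling)
open Literature.MathematicalPhysics.QuantumFieldTheory.Balaban1983to89.Node00.Sect2 (domSys domCount CPair ofBackgroundC spaceI domSites Setting Residual)
open Literature.MathematicalPhysics.QuantumFieldTheory.Balaban1983to89.Node00.W1
open YMDAG.UVSplit

variable {N : ℕ} [NeZero N]

/-! ## §1 The older-coupling level-T hypothesis on a generated tower from the two per-step generator schemas -/

section Generated

variable {F : T4Family} (k : ℕ) {𝔸 : Type*} [NormedRing 𝔸] [NormedAlgebra ℂ 𝔸] [CompleteSpace 𝔸] {G : Type*} [GaugeGroup G] {M : ℕ}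
  (Sg : Setting 𝔸 G) (Rz : Residual (F.P k) 𝔸) (Gn : GenTower (F.P k) 𝔸 M) (K : ℕ)

open Classical in
/-- **THE OLDER-COUPLING LEVEL-T HYPOTHESIS, UNIVERSAL IN THE DOMAIN, ON THE TOWER GENERATED BY `Gn`, FROM TWO PER-STEP SCHEMAS** at the steps `k′ < K`:
(S-loc) `hloc` — the step-`k′` activity `(Gn k′).H t old φ Z` reads the older terms `old` on the space tables `U^c_j(Y, cs.α₀, cs.α₁)` only; (S-226) `h226G` — for every
open `D ⊇` the closed `r`-discs about `]0, γ]`, every real last coupling `s ∈ ]0, γ]`, every older-terms curve `cv : ℂ → OlderTerms` whose components on the space tables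
are holomorphic on `D` with `‖cv z j Y ψ‖ ≤ A·e^{−κ d_j(Y)}` there, and every `X ∈ 𝐃_{k′+1}`, `φ ∈ U^c_{k′+1}(X)`: complexified term values `Tt` over print's
`terms L M Z` with `z ↦ (Gn k′).H ↑s (cv z) φ Z` holomorphic on `D`, dominated by `Σ_t ‖Tt Z t z‖` on `D`, each `‖Tt Z t z‖ ≤ weight(t)·e^{a₅|Z|}` ([II] (2.14)–(2.26) with
complex old terms) ⟹ module 15′ §1's `hbelow`: the `h226TOnOlder` body for `toClusterTower Gn` at the levels `k′ < K`.  The curve is CHOSEN from the premise (the lower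
terms' extensions on the spaces, `0` off them); the trace clause: `toClusterTower_H`, (S-loc), `termC_toClusterTower`, `recTerm_congr_prefix`, `histOfPrefix_restrictPrefix`.
[cite: Balaban1988RG2Cluster, (2.14)-(2.15) p.15 and (2.26) p.17; Balaban1987RG1, §0 p.256 and (2.12)-(2.13) p.268] -/
theorem termwise226OnOlder_toClusterTower_of_stepSchemas [NeZero M] {cs : SFConsts} {γ r A κ : ℝ} (c : B13.Consts) {L : ℕ} [NeZero L] {a a₅ : ℝ}
    (hloc : ∀ (k' : ℕ), k' < K → ∀ (t : ℂ) (old old' : OlderTerms (F.P k) 𝔸 M k') (φ : CPair (F.P k) 𝔸) (Z : (domSys (F.P k) M (k' + 1)).Dom),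
      (∀ (j : Fin (k' + 1)) (Y : (domSys (F.P k) M j).Dom) (ψ : CPair (F.P k) 𝔸), ψ ∈ spaceI Sg Rz M j (domSites (F.P k) M j Y) cs.α₀ cs.α₁ →
        old j Y ψ = old' j Y ψ) → (Gn k').H t old φ Z = (Gn k').H t old' φ Z)
    (h226G : ∀ (k' : ℕ), k' < K → ∀ (D : Set ℂ), IsOpen D → (∀ t ∈ Ioc (0 : ℝ) γ, closedBall (t : ℂ) r ⊆ D) → ∀ (s : ℝ), s ∈ Ioc (0 : ℝ) γ →
      ∀ (cv : ℂ → OlderTerms (F.P k) 𝔸 M k'),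
      (∀ (j : Fin (k' + 1)) (Y : (domSys (F.P k) M j).Dom) (ψ : CPair (F.P k) 𝔸), ψ ∈ spaceI Sg Rz M j (domSites (F.P k) M j Y) cs.α₀ cs.α₁ →
        DifferentiableOn ℂ (fun z => cv z j Y ψ) D ∧ ∀ z ∈ D, ‖cv z j Y ψ‖ ≤ A * Real.exp (-(κ * torusTreeLen Y.1))) →
      ∀ (X : (domSys (F.P k) M (k' + 1)).Dom) (φ : CPair (F.P k) 𝔸), φ ∈ spaceI Sg Rz M (k' + 1) (domSites (F.P k) M (k' + 1) X) cs.α₀ cs.α₁ →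
      ∃ Tt : (Z : TDom 4 (domCount (F.P k) M (k' + 1))) →
          Finset (TDom 4 (L * domCount (F.P k) M (k' + 1))) × Finset (TBond 4 M (L * domCount (F.P k) M (k' + 1))) → ℂ → ℂ,
        (∀ Z : (domSys (F.P k) M (k' + 1)).Dom, Z.1 ⊆ X.1 → DifferentiableOn ℂ (fun z => (Gn k').H (s : ℂ) (cv z) φ Z) D) ∧
        (∀ z ∈ D, ∀ Z : TDom 4 (domCount (F.P k) M (k' + 1)), Z.1 ⊆ X.1 → ‖(Gn k').H (s : ℂ) (cv z) φ Z‖ ≤ ∑ t ∈ terms L M Z, ‖Tt Z t z‖) ∧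
        (∀ z ∈ D, ∀ Z : TDom 4 (domCount (F.P k) M (k' + 1)), Z.1 ⊆ X.1 → ∀ t ∈ terms L M Z,
          ‖Tt Z t z‖ ≤ weight L M c Z a t * Real.exp (a₅ * ((Z.1).card : ℝ)))) :
    ∀ (D : Set ℂ), IsOpen D → (∀ t ∈ Ioc (0 : ℝ) γ, closedBall (t : ℂ) r ⊆ D) →
      ∀ (k' : ℕ), k' < K → ∀ (g : ℕ → ℝ), g ∈ Window γ → ∀ (i : ℕ), i < k' → ∀ (X : (domSys (F.P k) M (k' + 1)).Dom) (φ : CPair (F.P k) 𝔸),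
      φ ∈ spaceI Sg Rz M (k' + 1) (domSites (F.P k) M (k' + 1) X) cs.α₀ cs.α₁ →
      (∀ (j : ℕ), j < k' + 1 → ∀ (Y : (domSys (F.P k) M j).Dom) (ψ : CPair (F.P k) 𝔸), ψ ∈ spaceI Sg Rz M j (domSites (F.P k) M j Y) cs.α₀ cs.α₁ →
        ∃ Ec : ℂ → ℂ, DifferentiableOn ℂ Ec D ∧ (∀ z ∈ D, ‖Ec z‖ ≤ A * Real.exp (-(κ * torusTreeLen Y.1))) ∧
          (∀ t ∈ Ioc (0 : ℝ) γ, Ec t = termC (toClusterTower Gn) j Y (Function.update g i t) ψ)) →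
      ∃ (Hc : ℂ → TDom 4 (domCount (F.P k) M (k' + 1)) → ℂ)
        (Tt : (Z : TDom 4 (domCount (F.P k) M (k' + 1))) →
          Finset (TDom 4 (L * domCount (F.P k) M (k' + 1))) × Finset (TBond 4 M (L * domCount (F.P k) M (k' + 1))) → ℂ → ℂ),
        (∀ Z : (domSys (F.P k) M (k' + 1)).Dom, Z.1 ⊆ X.1 → DifferentiableOn ℂ (fun z => Hc z Z) D) ∧
        (∀ z ∈ D, ∀ Z : TDom 4 (domCount (F.P k) M (k' + 1)), Z.1 ⊆ X.1 → ‖Hc z Z‖ ≤ ∑ t ∈ terms L M Z, ‖Tt Z t z‖) ∧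
        (∀ z ∈ D, ∀ Z : TDom 4 (domCount (F.P k) M (k' + 1)), Z.1 ⊆ X.1 → ∀ t ∈ terms L M Z,
          ‖Tt Z t z‖ ≤ weight L M c Z a t * Real.exp (a₅ * ((Z.1).card : ℝ))) ∧
        (∀ t ∈ Ioc (0 : ℝ) γ, Hc t = ((toClusterTower Gn) k').H (restrictPrefix k' (Function.update g i t)) φ) := by
  intro D hD hdisc k' hk g hg i hi X φ hφ hprem
  -- the older-terms curve, CHOSEN from the premise on the space tables (`0` off them)
  choose Ec hEc using hprem
  let cv : ℂ → OlderTerms (F.P k) 𝔸 M k' := fun z j Y ψ =>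
    if hψ : ψ ∈ spaceI Sg Rz M j (domSites (F.P k) M j Y) cs.α₀ cs.α₁ then Ec j.1 j.2 Y ψ hψ z else 0
  have hcv : ∀ (j : Fin (k' + 1)) (Y : (domSys (F.P k) M j).Dom) (ψ : CPair (F.P k) 𝔸)
      (hψ : ψ ∈ spaceI Sg Rz M j (domSites (F.P k) M j Y) cs.α₀ cs.α₁) (z : ℂ), cv z j Y ψ = Ec j.1 j.2 Y ψ hψ z := fun j Y ψ hψ z => dif_pos hψ
  obtain ⟨Tt, hhol, hdom, hwt⟩ := h226G k' hk D hD hdisc (g k') (hg k') cv (fun j Y ψ hψ => by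
    refine ⟨((hEc j.1 j.2 Y ψ hψ).1).congr fun z _ => hcv j Y ψ hψ z, fun z hz => ?_⟩
    rw [hcv j Y ψ hψ z]
    exact (hEc j.1 j.2 Y ψ hψ).2.1 z hz) X φ hφ
  refine ⟨fun z Z => (Gn k').H ((g k' : ℝ) : ℂ) (cv z) φ Z, Tt, hhol, hdom, hwt, fun t ht => ?_⟩
  -- the trace clause: the coupling `g_i`, `i < k'`, is not the last one; the older terms generated at `g|g_i := t` ARE the curve at `t` on the spaces
  funext Z
  rw [toClusterTower_H]
  have hlast : (((restrictPrefix k' (Function.update g i t)) (Fin.last k') : ℝ) : ℂ) = ((g k' : ℝ) : ℂ) := by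
    show (((Function.update g i t) k' : ℝ) : ℂ) = _
    rw [Function.update_of_ne (Nat.ne_of_lt hi).symm]
  rw [hlast]
  refine hloc k' hk _ _ _ φ Z fun j Y ψ hψ => ?_
  rw [hcv j Y ψ hψ, (hEc j.1 j.2 Y ψ hψ).2.2 t ht, termC_toClusterTower, olderOf_apply]
  exact recTerm_congr_prefix Gn j.1 (fun n hn => (histOfPrefix_restrictPrefix (Function.update g i t) (lt_trans hn j.2)).symm) Y ψ

end Generated

/-! ## §2 `N22At` at the admissible reading of record on the towers of the runs of record GENERATED by per-torus generator towers -/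

section GeneratedReading

variable {F : T4Family} {M : ℕ} (Gn : (k : ℕ) → GenTower (F.P k) (MatA N) M)
  (sp : (k j : ℕ) → (domSys (F.P k) M j).Dom → Set (CPair (F.P k) (MatA N)))
  (gauge : (k : ℕ) → GaugeField (F.P k) 0 (Node00.SU N) → GaugeField (F.P k) 0 (Node00.SU N) → ℝ) (hg : ∀ k U U', 0 ≤ gauge k U U')
  (T₀ : (k : ℕ) → GaugeField (F.P (k + 1)) 0 (Node00.SU N) → GaugeField (F.P k) 0 (Node00.SU N))
  (hT₀ : ∀ (k : ℕ) (U : GaugeField (F.P (k + 1)) 0 (Node00.SU N)),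
    (∀ (j : ℕ) (Y : (domSys (F.P (k + 1)) M j).Dom), ofBackgroundC (ιSU N) U ∈ sp (k + 1) j Y) →
    ∀ (j : ℕ) (Y : (domSys (F.P k) M j).Dom), ofBackgroundC (ιSU N) (T₀ k U) ∈ sp k j Y)
  (li : LetterInputs) (θ : Stage12Params F N) (k : ℕ) {G : Type*} [GaugeGroup G]
  (Sg : Setting (MatA N) G) (Rz : Residual (F.P k) (MatA N)) (logZ : ℕ → GaugeField (F.P k) 0 G → ℝ) (β : ℕ → ℝ → ℝ)

open Classical in
/-- **`N22At` AT THE ADMISSIBLE READING OF RECORD ON THE TOWERS OF THE RUNS OF RECORD GENERATED BY `Gn`** (`Dr := ReadingData.ofRecordAdm F M N (runTowers fun k ↦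
toClusterTower (Gn k)) sp gauge hg T₀ hT₀ li`; module 15′ §3 at `S₀ k := toClusterTower (Gn k)` with its older-coupling hypothesis SUPPLIED by §1): the per-step generator
schemas (S-loc) and (S-226) at the steps `k′ < k` of the `k`-th torus (node N10's lane, generator language — NO couplings, NO histories), node N09's `EHoloAt` family on
`sfTowerOfRecord Sg Rz M (toClusterTower (Gn k)) ⟨g, β⟩ logZ` below the run length, `∀ k′ < k, N18At (…)` (node N18), the `hspk` inclusion, the socket numerals + S25 +
renewal, the letter signs ⟹ `N22At (u3OfRecord₁₂ θ (Dr.u3Objects θ.γ) k)`. [cite: Balaban1987RG1, (0.23)-(0.25) pp.256-257, (1.18) p.263 and (2.12)-(2.13) p.268; Balaban1988RG2Cluster, (2.13)-(2.15) pp.14-15, (2.26) p.17 and (2.40)-(2.41) p.21] -/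
theorem n22At_u3OfRecord₁₂_ofRecordAdm_runTowers_toClusterTower_of_n18Below_stepSchemas_eHoloAt [NeZero M] {cs : SFConsts}
    (hspk : ∀ (j : ℕ) (Y : (domSys (F.P k) M j).Dom), sp k j Y ⊆ spaceI Sg Rz M j (domSites (F.P k) M j Y) cs.α₀ cs.α₁)
    (c : B13.Consts) {L : ℕ} [NeZero L] (hL : 8 ≤ c.L) (hLc : c.L = L) {a a₂ a₂' a₅ Aabs : ℝ}
    (hN : Lemma3Numerics c M ((c.L : ℝ) / 2) a a₂ a₂' a₅ Aabs) {r₁ : ℝ} (hA0 : 0 ≤ c.C3act * c.ε₁) (hr₁ : 0 ≤ r₁) (hκ : li.κ ≤ r₁)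
    (hrate : r₁ + 2 * (64 * Real.log 162) + 2 ≤ (1 - 8 * c.δ) * ((c.L : ℝ) / 2) * c.κ)
    (hsmall : c.C3act * c.ε₁ * Real.exp (5 * r₁ + 1) * K₀ 64 8 * 9 * 64 ≤ 1)
    (hrenew : Real.exp 1 * 9 * 64 * K₀ 64 8 ^ 2 * (c.C3act * c.ε₁) ≤ li.A) (hγc : θ.γ ≤ cs.γ) (hκc : li.κ ≤ cs.κ)
    (hloc : ∀ (k' : ℕ), k' < k → ∀ (t : ℂ) (old old' : OlderTerms (F.P k) (MatA N) M k') (φ : CPair (F.P k) (MatA N))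
      (Z : (domSys (F.P k) M (k' + 1)).Dom),
      (∀ (j : Fin (k' + 1)) (Y : (domSys (F.P k) M j).Dom) (ψ : CPair (F.P k) (MatA N)), ψ ∈ spaceI Sg Rz M j (domSites (F.P k) M j Y) cs.α₀ cs.α₁ →
        old j Y ψ = old' j Y ψ) → (Gn k k').H t old φ Z = (Gn k k').H t old' φ Z)
    (h226G : ∀ (k' : ℕ), k' < k → ∀ (D : Set ℂ), IsOpen D → (∀ t ∈ Ioc (0 : ℝ) θ.γ, closedBall (t : ℂ) li.r ⊆ D) → ∀ (s : ℝ), s ∈ Ioc (0 : ℝ) θ.γ →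
      ∀ (cv : ℂ → OlderTerms (F.P k) (MatA N) M k'),
      (∀ (j : Fin (k' + 1)) (Y : (domSys (F.P k) M j).Dom) (ψ : CPair (F.P k) (MatA N)), ψ ∈ spaceI Sg Rz M j (domSites (F.P k) M j Y) cs.α₀ cs.α₁ →
        DifferentiableOn ℂ (fun z => cv z j Y ψ) D ∧ ∀ z ∈ D, ‖cv z j Y ψ‖ ≤ li.A * Real.exp (-(li.κ * torusTreeLen Y.1))) →
      ∀ (X : (domSys (F.P k) M (k' + 1)).Dom) (φ : CPair (F.P k) (MatA N)), φ ∈ spaceI Sg Rz M (k' + 1) (domSites (F.P k) M (k' + 1) X) cs.α₀ cs.α₁ →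
      ∃ Tt : (Z : TDom 4 (domCount (F.P k) M (k' + 1))) →
          Finset (TDom 4 (L * domCount (F.P k) M (k' + 1))) × Finset (TBond 4 M (L * domCount (F.P k) M (k' + 1))) → ℂ → ℂ,
        (∀ Z : (domSys (F.P k) M (k' + 1)).Dom, Z.1 ⊆ X.1 → DifferentiableOn ℂ (fun z => (Gn k k').H (s : ℂ) (cv z) φ Z) D) ∧
        (∀ z ∈ D, ∀ Z : TDom 4 (domCount (F.P k) M (k' + 1)), Z.1 ⊆ X.1 → ‖(Gn k k').H (s : ℂ) (cv z) φ Z‖ ≤ ∑ t ∈ terms L M Z, ‖Tt Z t z‖) ∧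
        (∀ z ∈ D, ∀ Z : TDom 4 (domCount (F.P k) M (k' + 1)), Z.1 ⊆ X.1 → ∀ t ∈ terms L M Z,
          ‖Tt Z t z‖ ≤ weight L M c Z a t * Real.exp (a₅ * ((Z.1).card : ℝ))))
    (hE : ∀ g ∈ Window θ.γ, ∀ k' : ℕ, k' + 1 ≤ k →
      ∃ H : EHoloAt (sfTowerOfRecord Sg Rz M (toClusterTower (Gn k)) ⟨g, β⟩ logZ) cs k', H.E₀ ≤ li.A ∧ li.r ≤ H.r)
    (h18 : ∀ k' : ℕ, k' < k →
      N18At (u3OfRecord₁₂ θ ((ReadingData.ofRecordAdm F M N (runTowers fun k => toClusterTower (Gn k)) sp gauge hg T₀ hT₀ li).u3Objects θ.γ) k'))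
    (hC5 : 0 ≤ li.C₅) (hθ1 : li.θ₅ < 1) (hC₀' : 2 * li.C₅ / (1 - li.θ₅) ≤ li.C₀)
    (hC₀ : 0 < li.C₀) (hθ : 0 < li.θ₅) (hA : 0 < li.A) (hμ1 : 1 ≤ li.μ) (hθμ : li.θ₅ ≤ li.μ) (hCM : li.C₀ ≤ 2 * li.A)
    (hr : 0 < li.r) (hγ : 0 < θ.γ) (hs0 : 0 < li.s) (hs1 : li.s < 1) :
    N22At (u3OfRecord₁₂ θ ((ReadingData.ofRecordAdm F M N (runTowers fun k => toClusterTower (Gn k)) sp gauge hg T₀ hT₀ li).u3Objects θ.γ) k) :=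
  n22At_u3OfRecord₁₂_ofRecordAdm_runTowers_of_n18Below_termwise226OnOlder_eHoloAt (fun k => toClusterTower (Gn k)) sp gauge hg T₀ hT₀ li θ k Sg Rz logZ β
    hspk c hL hLc hN hA0 hr₁ hκ hrate hsmall hrenew hγc hκc (termwise226OnOlder_toClusterTower_of_stepSchemas k Sg Rz (Gn k) k c hloc h226G) hE h18
    hC5 hθ1 hC₀' hC₀ hθ hA hμ1 hθμ hCM hr hγ hs0 hs1

end GeneratedReading

/-! ## §2b THE ₁₂ EDGE N18 → N22 at the admissible reading of record on GENERATED towers of the runs of record (edition-1 home) -/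

section GeneratedEdge

variable (Gn : (F : T4Family) → (θ : Stage12Params F N) → (k : ℕ) → GenTower (F.P k) (MatA N) θ.τ9.M)
  (sp : (F : T4Family) → (θ : Stage12Params F N) → (k j : ℕ) → (domSys (F.P k) θ.τ9.M j).Dom → Set (CPair (F.P k) (MatA N)))
  (gauge : (F : T4Family) → (θ : Stage12Params F N) → (k : ℕ) → GaugeField (F.P k) 0 (Node00.SU N) → GaugeField (F.P k) 0 (Node00.SU N) → ℝ)
  (hg : ∀ (F : T4Family) (θ : Stage12Params F N) (k : ℕ) (U U' : GaugeField (F.P k) 0 (Node00.SU N)), 0 ≤ gauge F θ k U U')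
  (T₀ : (F : T4Family) → (θ : Stage12Params F N) → (k : ℕ) → GaugeField (F.P (k + 1)) 0 (Node00.SU N) → GaugeField (F.P k) 0 (Node00.SU N))
  (hT : ∀ (F : T4Family) (θ : Stage12Params F N) (k : ℕ) (U : GaugeField (F.P (k + 1)) 0 (Node00.SU N)),
    (∀ (j : ℕ) (Y : (domSys (F.P (k + 1)) θ.τ9.M j).Dom), ofBackgroundC (ιSU N) U ∈ sp F θ (k + 1) j Y) →
      ∀ (j : ℕ) (X : (domSys (F.P k) θ.τ9.M j).Dom), ofBackgroundC (ιSU N) (T₀ F θ k U) ∈ sp F θ k j X)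
  (li : (F : T4Family) → Stage12Params F N → LetterInputs) (ℓ₃ : T4Family → Node00.NE3Letters₁₁)
  (ne2 : (F : T4Family) → Stage12Params F N → (ℕ → ℝ) → List (ULoop F) → ℕ → Node00.NE2Objects₁₁)
  (ne1 : (F : T4Family) → Stage12Params F N → (ℕ → ℝ) → List (ULoop F) → NE1pCarriers) {G : Type*} [GaugeGroup G]

open Classical in
/-- **THE EDGE N18 → N22 AT THE ADMISSIBLE READING OF RECORD ON THE GENERATED TOWERS OF THE RUNS OF RECORD** (module 15′ §4 at `S₀ F θ k := toClusterTower (Gn F θ k)`,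
the older-coupling hypothesis SUPPLIED by §1): node N18's stub `S_N18 (RRec₁₂ 𝔯)` at `w1 := fun F θ ↦ ReadingData.ofRecordAdm F θ.τ9.M N (runTowers fun k ↦
toClusterTower (Gn F θ k)) (sp F θ) …` + the letter signs + per `(F, θ, k)` the EXISTENCE of the setting ∕ letters ∕ socket tuple with: the `hspk` inclusion, the numerals,
the per-step generator schemas (S-loc)_{k′<k} and (S-226)_{k′<k} for `Gn F θ k` (node N10's lane, generator language) and node N09's `EHoloAt` family on
`sfTowerOfRecord Sg Rz θ.τ9.M (toClusterTower (Gn F θ k)) ⟨g, β⟩ logZ` below the run length ⟹ node N22's stub `S_N22 (RRec₁₂ 𝔯)`. [cite: Balaban1987RG1, (0.23)-(0.25) pp.256-257, (1.18) p.263 and (2.12)-(2.13) p.268; Balaban1988RG2Cluster, (2.13)-(2.15) pp.14-15, (2.26) p.17 and (2.40)-(2.41) p.21] -/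
theorem s_N22_readingOfRecord₁₂_ofRecordAdm_runTowers_toClusterTower_of_s_N18_stepSchemas_eHoloAt
    (h18 : S_N18 (RRec₁₂ (readingOfRecord₁₂
      (fun F θ => ReadingData.ofRecordAdm F θ.τ9.M N (runTowers fun k => toClusterTower (Gn F θ k)) (sp F θ) (gauge F θ) (hg F θ) (T₀ F θ) (hT F θ)
        (li F θ)) ℓ₃ ne2 ne1)))
    (hnum : ∀ (F : T4Family) (θ : Stage12Params F N), θ.Provisos₁₂ F N → θ.Admissible F N →
      0 < (li F θ).C₀ ∧ 0 < (li F θ).θ₅ ∧ (li F θ).θ₅ < 1 ∧ 0 ≤ (li F θ).C₅ ∧ 2 * (li F θ).C₅ / (1 - (li F θ).θ₅) ≤ (li F θ).C₀ ∧ 0 < (li F θ).A ∧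
        (li F θ).θ₅ ≤ (li F θ).μ ∧ (li F θ).C₀ ≤ 2 * (li F θ).A ∧ 0 < (li F θ).r ∧ 0 < (li F θ).s ∧ (li F θ).s < 1 ∧ 1 ≤ (li F θ).μ)
    (hdata : ∀ (F : T4Family) (θ : Stage12Params F N), θ.Provisos₁₂ F N → θ.Admissible F N → ∀ (k : ℕ),
      ∃ (_ : NeZero θ.τ9.M) (Sg : Setting (MatA N) G) (Rz : Residual (F.P k) (MatA N)) (logZ : ℕ → GaugeField (F.P k) 0 G → ℝ) (β : ℕ → ℝ → ℝ)
        (cs : SFConsts) (c : B13.Consts) (L : ℕ) (_ : NeZero L) (a a₂ a₂' a₅ Aabs r₁ : ℝ),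
        (∀ (j : ℕ) (Y : (domSys (F.P k) θ.τ9.M j).Dom), sp F θ k j Y ⊆ spaceI Sg Rz θ.τ9.M j (domSites (F.P k) θ.τ9.M j Y) cs.α₀ cs.α₁) ∧
        8 ≤ c.L ∧ c.L = L ∧ Lemma3Numerics c θ.τ9.M ((c.L : ℝ) / 2) a a₂ a₂' a₅ Aabs ∧ 0 ≤ c.C3act * c.ε₁ ∧ 0 ≤ r₁ ∧ (li F θ).κ ≤ r₁ ∧
        r₁ + 2 * (64 * Real.log 162) + 2 ≤ (1 - 8 * c.δ) * ((c.L : ℝ) / 2) * c.κ ∧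
        c.C3act * c.ε₁ * Real.exp (5 * r₁ + 1) * K₀ 64 8 * 9 * 64 ≤ 1 ∧
        Real.exp 1 * 9 * 64 * K₀ 64 8 ^ 2 * (c.C3act * c.ε₁) ≤ (li F θ).A ∧ θ.γ ≤ cs.γ ∧ (li F θ).κ ≤ cs.κ ∧
        (∀ (k' : ℕ), k' < k → ∀ (t : ℂ) (old old' : OlderTerms (F.P k) (MatA N) θ.τ9.M k') (φ : CPair (F.P k) (MatA N))
          (Z : (domSys (F.P k) θ.τ9.M (k' + 1)).Dom),
          (∀ (j : Fin (k' + 1)) (Y : (domSys (F.P k) θ.τ9.M j).Dom) (ψ : CPair (F.P k) (MatA N)),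
            ψ ∈ spaceI Sg Rz θ.τ9.M j (domSites (F.P k) θ.τ9.M j Y) cs.α₀ cs.α₁ → old j Y ψ = old' j Y ψ) →
          (Gn F θ k k').H t old φ Z = (Gn F θ k k').H t old' φ Z) ∧
        (∀ (k' : ℕ), k' < k → ∀ (D : Set ℂ), IsOpen D → (∀ t ∈ Ioc (0 : ℝ) θ.γ, closedBall (t : ℂ) (li F θ).r ⊆ D) →
          ∀ (s : ℝ), s ∈ Ioc (0 : ℝ) θ.γ → ∀ (cv : ℂ → OlderTerms (F.P k) (MatA N) θ.τ9.M k'),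
          (∀ (j : Fin (k' + 1)) (Y : (domSys (F.P k) θ.τ9.M j).Dom) (ψ : CPair (F.P k) (MatA N)),
            ψ ∈ spaceI Sg Rz θ.τ9.M j (domSites (F.P k) θ.τ9.M j Y) cs.α₀ cs.α₁ →
            DifferentiableOn ℂ (fun z => cv z j Y ψ) D ∧ ∀ z ∈ D, ‖cv z j Y ψ‖ ≤ (li F θ).A * Real.exp (-((li F θ).κ * torusTreeLen Y.1))) →
          ∀ (X : (domSys (F.P k) θ.τ9.M (k' + 1)).Dom) (φ : CPair (F.P k) (MatA N)),
          φ ∈ spaceI Sg Rz θ.τ9.M (k' + 1) (domSites (F.P k) θ.τ9.M (k' + 1) X) cs.α₀ cs.α₁ →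
          ∃ Tt : (Z : TDom 4 (domCount (F.P k) θ.τ9.M (k' + 1))) →
              Finset (TDom 4 (L * domCount (F.P k) θ.τ9.M (k' + 1))) × Finset (TBond 4 θ.τ9.M (L * domCount (F.P k) θ.τ9.M (k' + 1))) → ℂ → ℂ,
            (∀ Z : (domSys (F.P k) θ.τ9.M (k' + 1)).Dom, Z.1 ⊆ X.1 → DifferentiableOn ℂ (fun z => (Gn F θ k k').H (s : ℂ) (cv z) φ Z) D) ∧
            (∀ z ∈ D, ∀ Z : TDom 4 (domCount (F.P k) θ.τ9.M (k' + 1)), Z.1 ⊆ X.1 →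
              ‖(Gn F θ k k').H (s : ℂ) (cv z) φ Z‖ ≤ ∑ t ∈ terms L θ.τ9.M Z, ‖Tt Z t z‖) ∧
            (∀ z ∈ D, ∀ Z : TDom 4 (domCount (F.P k) θ.τ9.M (k' + 1)), Z.1 ⊆ X.1 → ∀ t ∈ terms L θ.τ9.M Z,
              ‖Tt Z t z‖ ≤ weight L θ.τ9.M c Z a t * Real.exp (a₅ * ((Z.1).card : ℝ)))) ∧
        (∀ g ∈ Window θ.γ, ∀ k' : ℕ, k' + 1 ≤ k →
          ∃ H : EHoloAt (sfTowerOfRecord Sg Rz θ.τ9.M (toClusterTower (Gn F θ k)) ⟨g, β⟩ logZ) cs k', H.E₀ ≤ (li F θ).A ∧ (li F θ).r ≤ H.r)) :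
    S_N22 (RRec₁₂ (readingOfRecord₁₂
      (fun F θ => ReadingData.ofRecordAdm F θ.τ9.M N (runTowers fun k => toClusterTower (Gn F θ k)) (sp F θ) (gauge F θ) (hg F θ) (T₀ F θ) (hT F θ)
        (li F θ)) ℓ₃ ne2 ne1)) := by
  refine s_N22_readingOfRecord₁₂_ofRecordAdm_runTowers_of_s_N18_termwise226OnOlder_eHoloAt (G := G) (fun F θ k => toClusterTower (Gn F θ k)) sp gauge hg
    T₀ hT li ℓ₃ ne2 ne1 h18 hnum fun F θ hP hθ k => ?_
  obtain ⟨hMz, Sg, Rz, logZ, β, cs, c, L, hLz, a, a₂, a₂', a₅, Aabs, r₁, hspk, hL, hLc, hN, hA0, hr₁, hκ, hrate, hsmall, hrenew, hγc, hκc, hloc, h226G, hE⟩ :=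
    hdata F θ hP hθ k
  exact ⟨hMz, Sg, Rz, logZ, β, cs, c, L, hLz, a, a₂, a₂', a₅, Aabs, r₁, hspk, hL, hLc, hN, hA0, hr₁, hκ, hrate, hsmall, hrenew, hγc, hκc,
    termwise226OnOlder_toClusterTower_of_stepSchemas k Sg Rz (Gn F θ k) k c hloc h226G, hE⟩

end GeneratedEdge

/-! ## §3 Non-vacuity of the two generator schemas (A5 rider) -/

section Rider

variable {F : T4Family} (k : ℕ) {𝔸 : Type*} [NormedRing 𝔸] [NormedAlgebra ℂ 𝔸] [CompleteSpace 𝔸] {G : Type*} [GaugeGroup G] {M : ℕ}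
  (Sg : Setting 𝔸 G) (Rz : Residual (F.P k) 𝔸)

open Classical in
/-- **NON-VACUITY OF (S-loc) AND (S-226) (A5 rider).**  The TERMLESS generator tower (no indices: `idx Z = ∅`, so every activity is the empty sum `0`) carries both
per-step schemas at every step — (S-loc) trivially, (S-226) with `Tt := 0` (`0 ≤ weight·e^{a₅|Z|}` by `weight_nonneg`, `0 ≤ α₆ε₂`) — so §1 ∕ §2 are not vacuous
implications.  Model generator, NOT NODE 00's (junk-shaped per ref-H WATCH-W1-DEGENERATE, labelled so). [folklore] -/
theorem stepSchemas_termlessGen [NeZero M] {cs : SFConsts} {γ r A κ : ℝ} (c : B13.Consts) {L : ℕ} [NeZero L] {a a₅ : ℝ} (hA6 : 0 ≤ c.α₆ * c.eps2)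
    (K : ℕ) :
    (∀ (k' : ℕ), k' < K → ∀ (t : ℂ) (old old' : OlderTerms (F.P k) 𝔸 M k') (φ : CPair (F.P k) 𝔸) (Z : (domSys (F.P k) M (k' + 1)).Dom),
      (∀ (j : Fin (k' + 1)) (Y : (domSys (F.P k) M j).Dom) (ψ : CPair (F.P k) 𝔸), ψ ∈ spaceI Sg Rz M j (domSites (F.P k) M j Y) cs.α₀ cs.α₁ →
        old j Y ψ = old' j Y ψ) →
      ((fun k' => (⟨PUnit, fun _ => ∅, fun _ _ _ _ => 0⟩ : StepGen (F.P k) 𝔸 M k')) k').H t old φ Z =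
        ((fun k' => (⟨PUnit, fun _ => ∅, fun _ _ _ _ => 0⟩ : StepGen (F.P k) 𝔸 M k')) k').H t old' φ Z) ∧
    (∀ (k' : ℕ), k' < K → ∀ (D : Set ℂ), IsOpen D → (∀ t ∈ Ioc (0 : ℝ) γ, closedBall (t : ℂ) r ⊆ D) → ∀ (s : ℝ), s ∈ Ioc (0 : ℝ) γ →
      ∀ (cv : ℂ → OlderTerms (F.P k) 𝔸 M k'),
      (∀ (j : Fin (k' + 1)) (Y : (domSys (F.P k) M j).Dom) (ψ : CPair (F.P k) 𝔸), ψ ∈ spaceI Sg Rz M j (domSites (F.P k) M j Y) cs.α₀ cs.α₁ →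
        DifferentiableOn ℂ (fun z => cv z j Y ψ) D ∧ ∀ z ∈ D, ‖cv z j Y ψ‖ ≤ A * Real.exp (-(κ * torusTreeLen Y.1))) →
      ∀ (X : (domSys (F.P k) M (k' + 1)).Dom) (φ : CPair (F.P k) 𝔸), φ ∈ spaceI Sg Rz M (k' + 1) (domSites (F.P k) M (k' + 1) X) cs.α₀ cs.α₁ →
      ∃ Tt : (Z : TDom 4 (domCount (F.P k) M (k' + 1))) →
          Finset (TDom 4 (L * domCount (F.P k) M (k' + 1))) × Finset (TBond 4 M (L * domCount (F.P k) M (k' + 1))) → ℂ → ℂ,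
        (∀ Z : (domSys (F.P k) M (k' + 1)).Dom, Z.1 ⊆ X.1 →
          DifferentiableOn ℂ (fun z => ((fun k' => (⟨PUnit, fun _ => ∅, fun _ _ _ _ => 0⟩ : StepGen (F.P k) 𝔸 M k')) k').H (s : ℂ) (cv z) φ Z) D) ∧
        (∀ z ∈ D, ∀ Z : TDom 4 (domCount (F.P k) M (k' + 1)), Z.1 ⊆ X.1 →
          ‖((fun k' => (⟨PUnit, fun _ => ∅, fun _ _ _ _ => 0⟩ : StepGen (F.P k) 𝔸 M k')) k').H (s : ℂ) (cv z) φ Z‖ ≤ ∑ t ∈ terms L M Z, ‖Tt Z t z‖) ∧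
        (∀ z ∈ D, ∀ Z : TDom 4 (domCount (F.P k) M (k' + 1)), Z.1 ⊆ X.1 → ∀ t ∈ terms L M Z,
          ‖Tt Z t z‖ ≤ weight L M c Z a t * Real.exp (a₅ * ((Z.1).card : ℝ)))) := by
  refine ⟨fun k' _ t old old' φ Z _ => by simp [StepGen.H], fun k' _ D _ _ s _ cv _ X φ _ => ⟨fun _ _ _ => 0, ?_, ?_, ?_⟩⟩
  · intro Z _
    simp only [StepGen.H, Finset.sum_empty]
    exact differentiableOn_const 0
  · intro z _ Z _
    simp [StepGen.H]
  · intro z _ Z _ t _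
    rw [norm_zero]
    exact mul_nonneg (weight_nonneg c Z a hA6 t) (Real.exp_pos _).le

end Rider

end YMDAG.N22.W1

end
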